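import Summits.HodgeConjecture.HodgeConjecture.Theorems.HeckePrymWeilWeilTwelvefoldsSqrtMinus7IsotypicOfTransport
import HarnessLib

/-!
# `WeilTwelvefoldsSqrtMinus7` from the route's own transport crux `WeilVariationalHodge` and four named facts

Crux `WeilTwelvefoldsSqrtMinus7` (stmt-HodgeConjecture-1261) of route `HeckePrymWeil`, line
`isotypic-unimodular-saturation` (lead seat c2), skeleton r1.  The line's one open stub, the Hecke–Prym-anchored
TRANSPORT (T) (`stub_transport`: variational Hodge for Weil classes on smooth projective families of
`ℚ(√-7)`-Weil 14-folds from one anchor fibre where the class is algebraic), is an INSTANCE of the route's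
uniform transport crux `HeckePrymWeil.WeilVariationalHodge` (stmt-HodgeConjecture-14497) at `(p, M) = (7, 7)`:
forget the Weil-plane memberships and the anchor structure, keep "every fibre is (isomorphic to) an abelian
14-fold with `φ_s ∘ φ_s = -7`" and "algebraic at `s₀`" (moved from the anchor `Y` back to the fibre along
`e.symm`).  Hence, with the line's deliverable `weilTwelvefolds_of_transport_and_facts`, the intra-route reduction
`WeilVariationalHodge (14497) + F1 + F2 + F3 + F4 ⟹ WeilTwelvefoldsSqrtMinus7 (1261)`, F1–F4 the Literature
named facts `Schoen1988_cyclicPrym_weilClasses_algebraic_degreeSeven`, `Motives.two_mul_dim_eq_finrank_bettiCohomology`,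
`weilFamily_hyperbolic_weilSystem_reach`, `exists_heckePrymDatum_F21`.
-/

noncomputable section

set_option linter.dupNamespace false

open CategoryTheory
open Literature.AlgebraicGeometry Literature.AlgebraicGeometry.Motives
  Literature.AlgebraicGeometry.HodgeTheory Literature.AlgebraicTopology.SingularHomology

namespace Summit.HodgeConjecture.HodgeConjecture.Theorems.WeilTwelvefoldsSqrtMinus7.IsotypicUnimodularSaturation

/-- **`WeilVariationalHodge` (stmt-HodgeConjecture-14497) ⟹ the Hecke–Prym-anchored transport (T)** of line
`isotypic-unimodular-saturation` (the registered stub `stub_transport`, verbatim): instantiate the route's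
uniform transport crux at `p = 7` (prime, `≡ 3 mod 4`), `M = 7`; the fibrewise Weil structures
`(Y_s, ψ_s, e_s)` supply "every fibre is an abelian 14-fold with `ψ_s ∘ ψ_s = -7`", and the anchor clause supplies
algebraicity at `s₀` after pulling back along `e.symm : 𝒳_{s₀} ≅ Y` (`mem_algebraicClasses_map_of_iso`).
[cite: Grothendieck1966, footnote 13 (variational Hodge)] [cite: CharlesSchnell2014Notes, Conj. 11.3.1] -/
theorem stub_transport_of_weilVariationalHodge
    (hW : Summit.HodgeConjecture.HodgeConjecture.Theses.HeckePrymWeil.WeilVariationalHodge) :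
 ∀ ⦃𝒳 S : SchemeOver ℂ⦄ (f : 𝒳 ⟶ S), IsSmoothProjectiveFamily f 14 →
      IrreducibleSpace S.left → AlgebraicGeometry.Smooth S.hom →
    ∀ (A : complexBetti 𝒳 14),
      (∀ s : ComplexPoints S,
        IsRationalClass (complexBetti.map (fiberι f s) 14 A) ∧
        IsOfHodgeType 14 (fiberOver f s) 14 7 7 (complexBetti.map (fiberι f s) 14 A)) →
      -- every fibre is a Weil-type abelian 14-fold on which `A` restricts into the typed Weil plane
      (∀ s : ComplexPoints S, ∃ (Ys : AbelianVariety ℂ) (ψs : Ys ⟶ Ys) (es : Ys.X ≅ fiberOver f s),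
        Ys.dim = 14 ∧ ψs ≫ ψs = -((7 : ℤ) • 𝟙 Ys) ∧
        complexBetti.map es.hom 14 (complexBetti.map (fiberι f s) 14 A) ∈
          Module.End.eigenspace (complexBetti.map (𝟙 Ys + ψs).hom.hom.hom 14).hom
              ((1 + Complex.I * (Real.sqrt (7 : ℝ) : ℂ)) ^ 14) ⊔
            Module.End.eigenspace (complexBetti.map (𝟙 Ys + ψs).hom.hom.hom 14).hom
              ((1 - Complex.I * (Real.sqrt (7 : ℝ) : ℂ)) ^ 14)) →
      -- ONE fibre is a Hecke–Prym-product anchor (up to isogeny) on which `A` is an ALGEBRAIC Weil class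
      (∃ (s₀ : ComplexPoints S) (Y : AbelianVariety ℂ) (ψ : Y ⟶ Y) (e : Y.X ≅ fiberOver f s₀),
        Y.dim = 14 ∧ ψ ≫ ψ = -((7 : ℤ) • 𝟙 Y) ∧
        (∃ (C : SchemeOver ℂ) (𝒥 : Jacobian C) (σ τ : C ⟶ C) (s t eN : 𝒥.J ⟶ 𝒥.J)
            (sB tB : AbelianVariety.kerComponent eN ⟶ AbelianVariety.kerComponent eN)
            (φ' : AbelianVariety.kerComponent (𝟙 (AbelianVariety.kerComponent eN) - tB) ⟶
              AbelianVariety.kerComponent (𝟙 (AbelianVariety.kerComponent eN) - tB))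
            (B' : AbelianVariety ℂ) (φB' : B' ⟶ B')
            (fY : Y ⟶ (AbelianVariety.kerComponent (𝟙 (AbelianVariety.kerComponent eN) - tB)).prod B')
            (gY : (AbelianVariety.kerComponent (𝟙 (AbelianVariety.kerComponent eN) - tB)).prod B' ⟶ Y)
            (m : ℕ),
          IsSmoothProjective 1 C ∧ 𝒥.J.dim = 43 ∧
          σ ≫ σ ≫ σ ≫ σ ≫ σ ≫ σ ≫ σ = 𝟙 C ∧ τ ≫ τ ≫ τ = 𝟙 C ∧ σ ≫ τ = τ ≫ σ ≫ σ ∧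
          (∀ P : ComplexPoints C, P ≫ σ ≠ P ∧ P ≫ τ ≠ P) ∧
          s = 𝒥.pushforward 𝒥 σ ∧ t = 𝒥.pushforward 𝒥 τ ∧
          eN = 𝟙 𝒥.J + s + s ≫ s + s ≫ s ≫ s + s ≫ s ≫ s ≫ s + s ≫ s ≫ s ≫ s ≫ s +
            s ≫ s ≫ s ≫ s ≫ s ≫ s ∧
          sB ≫ AbelianVariety.kerComponentι eN = AbelianVariety.kerComponentι eN ≫ s ∧
          tB ≫ AbelianVariety.kerComponentι eN = AbelianVariety.kerComponentι eN ≫ t ∧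
          φ' ≫ AbelianVariety.kerComponentι (𝟙 (AbelianVariety.kerComponent eN) - tB) =
            AbelianVariety.kerComponentι (𝟙 (AbelianVariety.kerComponent eN) - tB) ≫
              (sB + sB ≫ sB + sB ≫ sB ≫ sB ≫ sB - sB ≫ sB ≫ sB - sB ≫ sB ≫ sB ≫ sB ≫ sB -
                sB ≫ sB ≫ sB ≫ sB ≫ sB ≫ sB) ∧
          B'.dim = 2 ∧ φB' ≫ φB' = -((7 : ℤ) • 𝟙 B') ∧
          (∀ b : complexBetti B'.X 2,
            b ∈ Module.End.eigenspace (complexBetti.map (𝟙 B' + φB').hom.hom.hom 2).hom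
                  ((1 + Complex.I * (Real.sqrt (7 : ℝ) : ℂ)) ^ 2) ⊔
                Module.End.eigenspace (complexBetti.map (𝟙 B' + φB').hom.hom.hom 2).hom
                  ((1 - Complex.I * (Real.sqrt (7 : ℝ) : ℂ)) ^ 2) →
            b ∈ algebraicClasses B'.X 1) ∧
          AlgebraicGeometry.Flat fY.hom.hom.hom.left ∧ 0 < m ∧ fY ≫ gY = m • 𝟙 Y ∧
          gY ≫ ψ = AbelianVariety.prodLift
            (AbelianVariety.fst (AbelianVariety.kerComponent (𝟙 (AbelianVariety.kerComponent eN) - tB)) B' ≫ φ')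
            (AbelianVariety.snd (AbelianVariety.kerComponent (𝟙 (AbelianVariety.kerComponent eN) - tB)) B' ≫ φB') ≫
            gY) ∧
        complexBetti.map e.hom 14 (complexBetti.map (fiberι f s₀) 14 A) ∈
          Module.End.eigenspace (complexBetti.map (𝟙 Y + ψ).hom.hom.hom 14).hom
              ((1 + Complex.I * (Real.sqrt (7 : ℝ) : ℂ)) ^ 14) ⊔
            Module.End.eigenspace (complexBetti.map (𝟙 Y + ψ).hom.hom.hom 14).hom
              ((1 - Complex.I * (Real.sqrt (7 : ℝ) : ℂ)) ^ 14) ∧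
        complexBetti.map e.hom 14 (complexBetti.map (fiberι f s₀) 14 A) ∈ algebraicClasses Y.X 7) →
    ∀ s : ComplexPoints S,
      complexBetti.map (fiberι f s) 14 A ∈ algebraicClasses (fiberOver f s) 7 := by
  intro 𝒳 S f hf hirr hsm A hall hweil hanchor s
  obtain ⟨s₀, Y, ψ, e, -, -, -, -, halg⟩ := hanchor
  have hfib : ∀ s : ComplexPoints S, ∃ (A' : AbelianVariety ℂ) (φ' : A' ⟶ A'),
      A'.dim = 2 * 7 ∧ φ' ≫ φ' = -(((7 : ℕ) : ℤ) • 𝟙 A') ∧ Nonempty (A'.X ≅ fiberOver f s) := by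
    intro s'
    obtain ⟨Ys, ψs, es, hdim, hψs, -⟩ := hweil s'
    exact ⟨Ys, ψs, hdim, by simpa using hψs, ⟨es⟩⟩
  have halg₀ : complexBetti.map (fiberι f s₀) 14 A ∈ algebraicClasses (fiberOver f s₀) 7 := by
    have key := mem_algebraicClasses_map_of_iso (p := 7)
      (AbelianVariety.isSmoothProjective_holds (A := Y)) (hf.isSmoothProjective s₀) e.symm halg
    have hid : complexBetti.map e.symm.hom 14 (complexBetti.map e.hom 14
        (complexBetti.map (fiberι f s₀) 14 A)) = complexBetti.map (fiberι f s₀) 14 A := by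
      rw [← CategoryTheory.comp_apply, ← complexBetti.map_comp, Iso.symm_hom, Iso.inv_hom_id,
        complexBetti.map_id]
      rfl
    rw [hid] at key
    exact key
  exact hW 7 (by norm_num) (by norm_num) le_rfl 7 (by norm_num) f hf hirr hsm A hall hfib ⟨s₀, halg₀⟩ s

/-- **`WeilVariationalHodge` (stmt-HodgeConjecture-14497) + (F1)–(F4) ⟹ `WeilTwelvefoldsSqrtMinus7` (stmt-HodgeConjecture-1261)**:
the intra-route reduction of the crux to the route's uniform transport crux and four Literature named facts
(Schoen 1988 / Patel–Zhang 2025 lines at degree 7; `dim J = g`; the hyperbolic Weil-family reach; the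
`F₂₁` Hecke–Prym datum), via `weilTwelvefolds_of_transport_and_facts`.
[cite: Schoen1988HodgeWeil, Cor. 3.1] [cite: vanGeemen1994HodgeAV, §5] [cite: Markman2025SurveySecant, §11.5 and §12] -/
theorem weilTwelvefolds_of_weilVariationalHodge_and_facts
    (hW : Summit.HodgeConjecture.HodgeConjecture.Theses.HeckePrymWeil.WeilVariationalHodge)
    (h₁ : Schoen1988_cyclicPrym_weilClasses_algebraic_degreeSeven)
    (h₂ : two_mul_dim_eq_finrank_bettiCohomology)
    (h₅ : weilFamily_hyperbolic_weilSystem_reach) (h₆ : exists_heckePrymDatum_F21) :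
    Summit.HodgeConjecture.HodgeConjecture.Theses.HeckePrymWeil.WeilTwelvefoldsSqrtMinus7 :=
  weilTwelvefolds_of_transport_and_facts (stub_transport_of_weilVariationalHodge hW) h₁ h₂ h₅ h₆

end Summit.HodgeConjecture.HodgeConjecture.Theorems.WeilTwelvefoldsSqrtMinus7.IsotypicUnimodularSaturation

end
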